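import Mathlib
import HarnessLib
import Literature.Computability.AlgebraicComplexity.PatternExpressions
import Literature.Computability.AlgebraicComplexity.ValiantClasses
import Literature.Combinatorics.SimpleGraph.TreeDecomposition
import Summits.ValiantsHypothesis.ValiantsHypothesis.Theorems.MonotoneRestorationMonotoneRestorationQPLinearWidthNarrowDetermined

/-!
# Route MonotoneRestoration, crux `MonotoneRestorationQP` (stmt-15886) / crux `OrbitRestorationQP`
# (stmt-18293) — K1 AND GAP 2 ARE EQUIVALENT MODULO (Q1) "DETERMINED ⇒ NARROW"

Helper file (`--supports stmt-ValiantsHypothesis-15886`), def-free.  `NarrowDetermined` proved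
K1 (`stub_narrowExpansionVP`, line `narrow-expansion`) ⇒ GAP 2 (`stub_homDeterminedVP`, line
`linear-width`).  This file records the converse MODULO the algebraic question (Q1) of
`…LinearWidthDeterminedVsNarrow.lean` / evidence `WIDTH-SCALE-CALIBRATION.md`, stated here as an explicit
hypothesis (same width on both sides; any polynomial loss in the width would do as well):

  (Q1)  at every level `n` and width `k`, a polynomial determined by `HomIndist n k` lies in the span of
        the `hom_{F,n}` with `tw F ≤ k`.

* `narrowExpansionVP_of_homDeterminedVP_of_Q1` — (Q1) → GAP 2 (verbatim) → K1 (verbatim);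
* `narrowExpansion_iff_polylogHomDetermined_of_Q1` — under (Q1), for every family `f`: "narrow
  expansion with polylog width" ↔ "`PolylogHomDetermined`" (both verbatim, up to the exponent shift
  `c ↦ c + 2` of `NarrowDetermined`).

So the two width lines of the route share ONE summit-strength node modulo (Q1), and (Q1) — true at
`k = 1` and `k ≥ max(4·(n!)², 2n)` (`DeterminedVsNarrow`, `OrbitSeparation`), open in between — is the
exact price of identifying them.  Honest label: bookkeeping; no stub closed; VP ≠ VNP not moved.
[cite: DwivediPagoSeppelt2026, Def. 3.2, Cor. 3.3]
-/

-- `Summit.ValiantsHypothesis.ValiantsHypothesis.…` is the tree's mandated namespace (Sub = Summit).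
set_option linter.dupNamespace false

noncomputable section

namespace Summit.ValiantsHypothesis.ValiantsHypothesis.Theorems

namespace NarrowDetermined

open Literature.Computability.AlgebraicComplexity MvPolynomial

/-- **(Q1) ⇒ (GAP 2 ⇒ K1).**  If determined polynomials are narrow of the same width at every level,
then `HomDeterminedVP` (verbatim) implies `stub_narrowExpansionVP`'s statement (verbatim). [folklore] -/
theorem narrowExpansionVP_of_homDeterminedVP_of_Q1
    (hQ1 : ∀ (n k : ℕ) (p : MvPolynomial (Fin n × Fin n) ℂ),
      (∀ A B : Fin n × Fin n → ℂ,
        (∀ (a b : ℕ) (E : Multiset (Fin a × Fin b)),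
          Literature.Combinatorics.SimpleGraph.treewidth
            (SimpleGraph.fromRel fun u v : Fin a ⊕ Fin b =>
              ∃ p ∈ E, u = Sum.inl p.1 ∧ v = Sum.inr p.2) < k →
          eval A (homPoly E n ℂ) = eval B (homPoly E n ℂ)) →
        eval A p = eval B p) →
      p ∈ Submodule.span ℂ
        {q : MvPolynomial (Fin n × Fin n) ℂ | ∃ (a b : ℕ) (E : Multiset (Fin a × Fin b)),
          Literature.Combinatorics.SimpleGraph.treewidth
              (SimpleGraph.fromRel fun u v : Fin a ⊕ Fin b =>
                ∃ e ∈ E, u = Sum.inl e.1 ∧ v = Sum.inr e.2) ≤ k ∧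
            q = homPoly E n ℂ})
    (hGAP2 : ∀ f : (n : ℕ) → MvPolynomial (Fin n × Fin n) ℂ,
      (∀ (n : ℕ) (σ τ : Equiv.Perm (Fin n)),
        MvPolynomial.rename (fun p : Fin n × Fin n => (σ p.1, τ p.2)) (f n) = f n) →
      IsVPFamily f →
      ∃ c : ℕ, ∀ (n : ℕ) (A B : Fin n × Fin n → ℂ),
        (∀ (a b : ℕ) (E : Multiset (Fin a × Fin b)),
          Literature.Combinatorics.SimpleGraph.treewidth
            (SimpleGraph.fromRel fun u v : Fin a ⊕ Fin b => ∃ p ∈ E, u = Sum.inl p.1 ∧ v = Sum.inr p.2) <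
            (Nat.log 2 n + c) ^ c →
          MvPolynomial.eval A (homPoly E n ℂ) = MvPolynomial.eval B (homPoly E n ℂ)) →
        MvPolynomial.eval A (f n) = MvPolynomial.eval B (f n)) :
    ∀ f : (n : ℕ) → MvPolynomial (Fin n × Fin n) ℂ,
      (∀ (n : ℕ) (σ τ : Equiv.Perm (Fin n)),
        MvPolynomial.rename (fun p : Fin n × Fin n => (σ p.1, τ p.2)) (f n) = f n) →
      IsVPFamily f →
      ∃ c : ℕ, ∀ n : ℕ, f n ∈ Submodule.span ℂ
        {p : MvPolynomial (Fin n × Fin n) ℂ | ∃ (a b : ℕ) (E : Multiset (Fin a × Fin b)),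
          Literature.Combinatorics.SimpleGraph.treewidth
              (SimpleGraph.fromRel fun u v : Fin a ⊕ Fin b =>
                ∃ e ∈ E, u = Sum.inl e.1 ∧ v = Sum.inr e.2) ≤ (Nat.log 2 n + c) ^ c ∧
            p = homPoly E n ℂ} := by
  intro f hsymm hVP
  obtain ⟨c, hc⟩ := hGAP2 f hsymm hVP
  exact ⟨c, fun n => hQ1 n _ (f n) (hc n)⟩

/-- **Under (Q1), NARROW ⟺ DETERMINED for families** (polylog width; both verbatim; exponent shift
`c ↦ c + 2` in the forward direction is `NarrowDetermined.polylogHomDetermined_of_narrowExpansion`).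
[folklore] -/
theorem narrowExpansion_iff_polylogHomDetermined_of_Q1
    (hQ1 : ∀ (n k : ℕ) (p : MvPolynomial (Fin n × Fin n) ℂ),
      (∀ A B : Fin n × Fin n → ℂ,
        (∀ (a b : ℕ) (E : Multiset (Fin a × Fin b)),
          Literature.Combinatorics.SimpleGraph.treewidth
            (SimpleGraph.fromRel fun u v : Fin a ⊕ Fin b =>
              ∃ p ∈ E, u = Sum.inl p.1 ∧ v = Sum.inr p.2) < k →
          eval A (homPoly E n ℂ) = eval B (homPoly E n ℂ)) →
        eval A p = eval B p) →
      p ∈ Submodule.span ℂ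
        {q : MvPolynomial (Fin n × Fin n) ℂ | ∃ (a b : ℕ) (E : Multiset (Fin a × Fin b)),
          Literature.Combinatorics.SimpleGraph.treewidth
              (SimpleGraph.fromRel fun u v : Fin a ⊕ Fin b =>
                ∃ e ∈ E, u = Sum.inl e.1 ∧ v = Sum.inr e.2) ≤ k ∧
            q = homPoly E n ℂ})
    (f : (n : ℕ) → MvPolynomial (Fin n × Fin n) ℂ) :
    (∃ c : ℕ, ∀ n : ℕ, f n ∈ Submodule.span ℂ
        {p : MvPolynomial (Fin n × Fin n) ℂ | ∃ (a b : ℕ) (E : Multiset (Fin a × Fin b)),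
          Literature.Combinatorics.SimpleGraph.treewidth
              (SimpleGraph.fromRel fun u v : Fin a ⊕ Fin b =>
                ∃ e ∈ E, u = Sum.inl e.1 ∧ v = Sum.inr e.2) ≤ (Nat.log 2 n + c) ^ c ∧
            p = homPoly E n ℂ}) ↔
    (∃ c : ℕ, ∀ (n : ℕ) (A B : Fin n × Fin n → ℂ),
      (∀ (a b : ℕ) (E : Multiset (Fin a × Fin b)),
        Literature.Combinatorics.SimpleGraph.treewidth
          (SimpleGraph.fromRel fun u v : Fin a ⊕ Fin b => ∃ p ∈ E, u = Sum.inl p.1 ∧ v = Sum.inr p.2) <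
          (Nat.log 2 n + c) ^ c →
        MvPolynomial.eval A (homPoly E n ℂ) = MvPolynomial.eval B (homPoly E n ℂ)) →
      MvPolynomial.eval A (f n) = MvPolynomial.eval B (f n)) :=
  ⟨polylogHomDetermined_of_narrowExpansion f, fun ⟨c, hc⟩ => ⟨c, fun n => hQ1 n _ (f n) (hc n)⟩⟩

end NarrowDetermined

end Summit.ValiantsHypothesis.ValiantsHypothesis.Theorems

end
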